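/-
Copyright: public-domain mathematics; typed transcription for the H21 Literature library (cell lit-balaban,
reader/typer seat r02 gen 5 = literature-prover-lit-balaban-r02-g5-0).

statement-level skeleton of published theorems with citation tags; proofs where landed; nothing here is a claim about the Yang–Mills mass gap

# Bałaban, *Propagators and renormalization transformations for lattice gauge theories. I*,
# Commun. Math. Phys. **95** (1984) 17–40 — the OPERATOR DICTIONARY through the site bridge `B5SiteBridgeP12.eFine`:
# the lattice derivatives `∂_ν`, `∂_ν^*`, the Laplacian `Δ` and the block average `Q` (1.18) of the two presentations agree

[cite: Balaban1984PropagatorsI]  T. Bałaban, Commun. Math. Phys. 95 (1984) 17–40.  p. 20 (1.18) (PDF p. 4): «(Q_kA)_μ(y) =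
Σ_{x∈B^k(y)} L^{−k(d+1)} Σ_{t} A(…)» (the vector block average); p. 21 (PDF p. 5): Δ the Laplace operator of the lattice T_η;
p. 23 (1.31): `∇_ν = η^{−1}(e^{iηp_ν} − 1)` in momentum space, i.e. `(∇_νf)(x) = η^{−1}(f(x + ηe_ν) − f(x))`; p. 39 (1.132)–(1.134):
`G₀ = (Δ + aQ*Q)^{−1}` — the operator whose two typings (`B5Prop11G0Torus.G0inv` on `Tor (fine n M) × Fin d`, p37's
`B5Eq133G0Torus.M0 P a 0 P.K μ` on `Site P 0`, per direction) this dictionary is for.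

WHAT THIS MODULE ADDS (SKELETON row B5.Prop1.2, owner's census (iv)/(vii); for the transport of «Prop. 1.1 for G₀» (p251794,
product-torus typing) to the tower typing of seat p37).  With `embA A (z, μ) := A μ (eFine⁻¹ z)` (a tower vector function read as
a bond function on the product torus, `ℂ`-valued):
* §1 shifts: `eFine (x + e_ν) = eFine x + e_ν`, `eFine (x − e_ν) = eFine x − e_ν`; pointwise formulas for `shiftMatᵀ`, `derivᵀ` (tower;
  the product-torus ones `shiftM_mulVec`, `fdiff_mulVec`, … are `B5G183FreeRowSum`'s);
* §2 **`∂_ν`, `∂_ν^*`, `Δ` agree**: `fdiff (fine n M) n ν *ᵥ embA A = embA (∂_ν A)` (`embA_deriv`, `ε^{−1} = L^K = n`), `fdiffᴴ ↔ derivᵀ`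
  (`embA_derivT`), `B5Prop11Lower.Lap *ᵥ embA A = embA (hOp P 0 ε 0 · A)` (`embA_Lap`) — the Laplacian half of `G₀^{−1} = Δ + aQ*Q`.

* §3 **the block average (1.18) agrees**: fibres `B^K(y)` ↔ block points `bpt` (`proj_eq_iff`), segments `shiftN ↔ tstep`
  (`eFine_shiftN`), the ENTRY identity `QvOp (eUnit y, μ) (eFine x, μ′) = [μ′ = μ]·Qv P K μ y x` (`QvOp_bridge`), whence
  `QvOp *ᵥ embA A = embQ (Q_K A)` (`QvOp_embA`), `QvAdj *ᵥ embQ B = embA (Q*_K B)` (`QvAdj_embQ`), and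
  **`G0inv n M a *ᵥ embA A = embA (⊕_μ M0 P a 0 K μ · A)`** (`G0inv_embA`): `Δ + aQ*Q` IS THE SAME OPERATOR in the two typings.

HONEST SCOPE.  Bookkeeping identities between two typings of the same finite-difference / block-averaging operators (the input
of the transport of «Prop. 1.1 for G₀» between the typings); nothing analytic.
-/
import Mathlib
import Literature.MathematicalPhysics.QuantumFieldTheory.Balaban1983to89.B5SiteBridgeP12
import Literature.MathematicalPhysics.QuantumFieldTheory.Balaban1983to89.B5Eq133G0Torus
import Literature.MathematicalPhysics.QuantumFieldTheory.Balaban1983to89.B5Prop11G0Torus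
import Literature.MathematicalPhysics.QuantumFieldTheory.Balaban1983to89.B5G183FreeRowSum

open scoped BigOperators Matrix Real ComplexConjugate
open Finset Matrix

namespace Literature.MathematicalPhysics.QuantumFieldTheory.Balaban1983to89.B5G0BridgeP12

open Literature.MathematicalPhysics.QuantumFieldTheory.Balaban1983to89
open Literature.MathematicalPhysics.QuantumFieldTheory.Balaban1983to89.B5Prop11Plancherel (Tor fine unitVec shiftM fdiff)
open Literature.MathematicalPhysics.QuantumFieldTheory.Balaban1983to89.B5Prop11Lower (Lap)
open Literature.MathematicalPhysics.QuantumFieldTheory.Balaban1983to89.B5G183FreeRowSum (shiftM_mulVec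
  shiftM_conjTranspose_mulVec fdiff_mulVec fdiff_conjTranspose_mulVec)
open Literature.MathematicalPhysics.QuantumFieldTheory.Balaban1983to89.B5SiteBridgeP12 (nP MP eFine eUnit eFine_apply eFine_val
  eUnit_blk)
open Literature.MathematicalPhysics.QuantumFieldTheory.Balaban1983to89.B5Block118 (tstep tstep_zero tstep_succ bpt QvOp)
open Literature.MathematicalPhysics.QuantumFieldTheory.Balaban1983to89.B5Blocks16 (bpt_bijective blockOf_bpt)
open Literature.MathematicalPhysics.QuantumFieldTheory.Balaban1983to89.B5DeltaA169 (QvAdj)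
open Literature.MathematicalPhysics.QuantumFieldTheory.Balaban1983to89.B5Prop11G0Torus (G0inv)
open Literature.MathematicalPhysics.QuantumFieldTheory.Balaban1983to89.B5Ineq137Torus (blk)
open Literature.MathematicalPhysics.QuantumFieldTheory.Balaban1983to89.B5Eq133G0Torus (shiftN shiftN_zero shiftN_succ Qv QvT M0
  Qv_mulVec M0_top)
open Literature.MathematicalPhysics.QuantumFieldTheory.Balaban1983to89.B1RG242Torus (shiftMat deriv hOp H shiftMat_mulVec
  deriv_mulVec hOp_mulVec lvl lvl_of_le)

noncomputable section

variable (P : Params)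

/-! ## §1 Shifts on both sides -/

/-- **`eFine (x + e_ν) = eFine x + e_ν`.** [cite: Balaban1984PropagatorsI, (1.31) p.23 (x + ηe_ν)] -/
theorem eFine_shift (x : Site P 0) (ν : Fin P.d) :
    eFine P (Site.shift x ν) = eFine P x + unitVec (fine (nP P) (MP P)) ν := by
  funext μ
  rw [Pi.add_apply, eFine_apply, eFine_apply, unitVec]
  by_cases h : μ = ν
  · subst h
    simp [Site.shift, map_add]
  · simp [Site.shift, Function.update_of_ne h, Pi.single_eq_of_ne h]

/-- **`eFine (x − e_ν) = eFine x − e_ν`.** [cite: Balaban1984PropagatorsI, (1.31) p.23 (x − ηe_ν)] -/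
theorem eFine_unshift (x : Site P 0) (ν : Fin P.d) :
    eFine P (Site.unshift x ν) = eFine P x - unitVec (fine (nP P) (MP P)) ν := by
  funext μ
  rw [Pi.sub_apply, eFine_apply, eFine_apply, unitVec]
  by_cases h : μ = ν
  · subst h
    simp [Site.unshift, map_sub]
  · simp [Site.unshift, Function.update_of_ne h, Pi.single_eq_of_ne h]

/-- `eFine⁻¹ (z + e_ν) = eFine⁻¹ z + e_ν`. [cite: Balaban1984PropagatorsI, (1.31) p.23] -/
theorem eFine_symm_add_unitVec (z : Tor (fine (nP P) (MP P))) (ν : Fin P.d) :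
    (eFine P).symm (z + unitVec (fine (nP P) (MP P)) ν) = Site.shift ((eFine P).symm z) ν := by
  apply (eFine P).injective
  rw [Equiv.apply_symm_apply, eFine_shift, Equiv.apply_symm_apply]

/-- `eFine⁻¹ (z − e_ν) = eFine⁻¹ z − e_ν`. [cite: Balaban1984PropagatorsI, (1.31) p.23] -/
theorem eFine_symm_sub_unitVec (z : Tor (fine (nP P) (MP P))) (ν : Fin P.d) :
    (eFine P).symm (z - unitVec (fine (nP P) (MP P)) ν) = Site.unshift ((eFine P).symm z) ν := by
  apply (eFine P).injective
  rw [Equiv.apply_symm_apply, eFine_unshift, Equiv.apply_symm_apply]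


/-- `x = x′ + e_μ ↔ x′ = x − e_μ` on the tower. [cite: Balaban1984PropagatorsI, (1.31) p.23] -/
theorem eq_shift_iff (μ : Fin P.d) (x x' : Site P 0) : x = Site.shift x' μ ↔ x' = Site.unshift x μ := by
  constructor
  · rintro rfl
    funext ρ
    by_cases h : ρ = μ
    · subst h; simp [Site.shift, Site.unshift]
    · simp [Site.shift, Site.unshift, Function.update_of_ne h]
  · rintro rfl
    funext ρ
    by_cases h : ρ = μ
    · subst h; simp [Site.shift, Site.unshift]
    · simp [Site.shift, Site.unshift, Function.update_of_ne h]

/-- `(shiftMatᵀ f)(x) = f(x − e_μ)`. [cite: Balaban1984PropagatorsI, (1.31) p.23] -/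
theorem shiftMat_transpose_mulVec (μ : Fin P.d) (f : Site P 0 → ℝ) (x : Site P 0) :
    ((shiftMat P 0 μ)ᵀ *ᵥ f) x = f (Site.unshift x μ) := by
  simp only [Matrix.mulVec, dotProduct, Matrix.transpose_apply, shiftMat]
  simp_rw [eq_shift_iff P μ x]
  simp only [ite_mul, one_mul, zero_mul, Finset.sum_ite_eq', Finset.mem_univ, if_true]

/-- `(∂_μᵀ f)(x) = s^{−1}(f(x − e_μ) − f(x))`. [cite: Balaban1984PropagatorsI, (1.31) p.23] -/
theorem derivT_mulVec (s : ℝ) (μ : Fin P.d) (f : Site P 0 → ℝ) (x : Site P 0) :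
    ((deriv P 0 s μ)ᵀ *ᵥ f) x = s⁻¹ * (f (Site.unshift x μ) - f x) := by
  unfold B1RG242Torus.deriv
  simp only [Matrix.transpose_smul, Matrix.transpose_sub, Matrix.transpose_one, Matrix.smul_mulVec,
    Matrix.sub_mulVec, Matrix.one_mulVec, Pi.smul_apply, Pi.sub_apply, shiftMat_transpose_mulVec, smul_eq_mul]

/-! ## §2 The embedding and the dictionary for `∂`, `∂*`, `Δ` -/

/-- **a tower vector function read as a bond function on the product torus**: `embA A (z, μ) = A_μ(eFine⁻¹ z)` (`ℂ`-valued).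
[cite: Balaban1984PropagatorsI, (1.18) p.20 (A_μ(x) = A(⟨x, x + e_μ⟩))] -/
def embA (A : Fin P.d → Site P 0 → ℝ) : Tor (fine (nP P) (MP P)) × Fin P.d → ℂ :=
  fun b => (A b.2 ((eFine P).symm b.1) : ℂ)

/-- unfolding at a bridged site. [cite: Balaban1984PropagatorsI, (1.18) p.20] -/
@[simp] theorem embA_apply (A : Fin P.d → Site P 0 → ℝ) (z : Tor (fine (nP P) (MP P))) (μ : Fin P.d) :
    embA P A (z, μ) = (A μ ((eFine P).symm z) : ℂ) := rfl

/-- unfolding at `eFine x`. [cite: Balaban1984PropagatorsI, (1.18) p.20] -/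
theorem embA_apply_eFine (A : Fin P.d → Site P 0 → ℝ) (x : Site P 0) (μ : Fin P.d) :
    embA P A (eFine P x, μ) = (A μ x : ℂ) := by
  rw [embA_apply, Equiv.symm_apply_apply]

/-- `embA` is injective (the two typings carry the same functions). [cite: Balaban1984PropagatorsI, (1.18) p.20] -/
theorem embA_injective : Function.Injective (embA P) := by
  intro A B h
  funext μ x
  have := congr_fun h (eFine P x, μ)
  rw [embA_apply_eFine, embA_apply_eFine] at this
  exact_mod_cast this

/-- `ε^{−1} = L^K = n`. [cite: Balaban1984PropagatorsI, p.35 («ε = L^{−K}»)] -/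
theorem eps_inv : (P.eps)⁻¹ = (nP P : ℝ) := by
  simp [Params.eps, nP]

/-- **`∂_ν` agrees**: `fdiff (fine n M) n ν (embA A) = embA (∂^ε_ν A)`. [cite: Balaban1984PropagatorsI, (1.31) p.23] -/
theorem embA_deriv (A : Fin P.d → Site P 0 → ℝ) (ν : Fin P.d) :
    fdiff (fine (nP P) (MP P)) (nP P : ℂ) ν *ᵥ embA P A = embA P (fun μ => deriv P 0 P.eps ν *ᵥ A μ) := by
  funext b
  obtain ⟨z, μ⟩ := b
  rw [fdiff_mulVec, embA_apply, embA_apply, embA_apply, deriv_mulVec, eFine_symm_add_unitVec, eps_inv]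
  push_cast
  ring

/-- **`∂_ν^*` agrees**: `fdiffᴴ (embA A) = embA (∂ᵀ_ν A)`. [cite: Balaban1984PropagatorsI, (1.31) p.23, (1.21) p.21] -/
theorem embA_derivT (A : Fin P.d → Site P 0 → ℝ) (ν : Fin P.d) :
    (fdiff (fine (nP P) (MP P)) (nP P : ℂ) ν)ᴴ *ᵥ embA P A = embA P (fun μ => (deriv P 0 P.eps ν)ᵀ *ᵥ A μ) := by
  funext b
  obtain ⟨z, μ⟩ := b
  rw [fdiff_conjTranspose_mulVec, embA_apply, embA_apply, embA_apply, derivT_mulVec, eFine_symm_sub_unitVec, eps_inv,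
    map_natCast]
  push_cast
  ring

/-- `embA` is additive. [cite: Balaban1984PropagatorsI, (1.18) p.20] -/
theorem embA_add (A B : Fin P.d → Site P 0 → ℝ) : embA P (A + B) = embA P A + embA P B := by
  funext b
  simp [embA]

/-- `embA` of a finite sum. [cite: Balaban1984PropagatorsI, (1.18) p.20] -/
theorem embA_sum {ι : Type*} (s : Finset ι) (A : ι → Fin P.d → Site P 0 → ℝ) :
    embA P (∑ i ∈ s, A i) = ∑ i ∈ s, embA P (A i) := by
  funext b
  simp [embA, Finset.sum_apply]

/-- **the Laplacian agrees**: `Lap (embA A) = embA (Δ^ε A)` (`Δ^ε = Σ_ν ∂ᵀ_ν∂_ν` componentwise, `B1RG242Torus.hOp` with m² = 0).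
[cite: Balaban1984PropagatorsI, (1.21) p.21 (Δ), (1.132) p.39] -/
theorem embA_Lap (A : Fin P.d → Site P 0 → ℝ) :
    Lap (nP P) (MP P) *ᵥ embA P A = embA P (fun μ => hOp P 0 P.eps 0 *ᵥ A μ) := by
  rw [Lap, Matrix.sum_mulVec]
  have h : ∀ ν : Fin P.d, ((fdiff (fine (nP P) (MP P)) (nP P : ℂ) ν)ᴴ * fdiff (fine (nP P) (MP P)) (nP P : ℂ) ν) *ᵥ embA P A
      = embA P (fun μ => (deriv P 0 P.eps ν)ᵀ *ᵥ (deriv P 0 P.eps ν *ᵥ A μ)) := by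
    intro ν
    rw [← Matrix.mulVec_mulVec, embA_deriv, embA_derivT]
  simp_rw [h]
  funext b
  obtain ⟨z, μ⟩ := b
  rw [Finset.sum_apply]
  simp only [embA_apply, hOp_mulVec, zero_smul, zero_add, Finset.sum_apply]
  push_cast
  rfl


/-- `embA` of `F + a•G` (real scalar). [cite: Balaban1984PropagatorsI, (1.132) p.39 (Δ + aQ*Q)] -/
theorem embA_add_smul (a : ℝ) (F G : Fin P.d → Site P 0 → ℝ) :
    embA P (fun μ => F μ + a • G μ) = embA P F + (a : ℂ) • embA P G := by
  funext b
  simp [embA]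

/-! ## §3 The block average `Q` of (1.18) agrees; `Δ + aQ*Q` agrees -/

/-- segments: `eFine (x + t e_μ) = eFine x + t e_μ`. [cite: Balaban1984PropagatorsI, (1.18) p.20] -/
theorem eFine_shiftN (x : Site P 0) (μ : Fin P.d) (t : ℕ) :
    eFine P (shiftN P x μ t) = eFine P x + tstep (fine (nP P) (MP P)) μ t := by
  induction t with
  | zero => rw [shiftN_zero, tstep_zero, add_zero]
  | succ t ih => rw [shiftN_succ, eFine_shift, ih, tstep_succ, add_assoc]

/-- the top-level block map of the tower is `blk`. [cite: Balaban1984PropagatorsI, (1.6) p.18] -/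
theorem proj_K_eq_blk (x : Site P 0) : Site.proj P.K P.K x = blk P P.K x := rfl

/-- **fibres ↔ block points**: `x ∈ B^K(y)` iff `eFine x = n·(eUnit y) + j` for some offset `j ∈ [0, n)^d`.
[cite: Balaban1984PropagatorsI, (1.6) p.18] -/
theorem proj_eq_iff (x : Site P 0) (y : Site P P.K) :
    Site.proj P.K P.K x = y ↔ ∃ j : Fin P.d → Fin (nP P), eFine P x = bpt (nP P) (MP P) (eUnit P y) j := by
  rw [proj_K_eq_blk]
  constructor
  · intro h
    obtain ⟨⟨y', j⟩, hyj⟩ := (bpt_bijective (nP P) (MP P)).2 (eFine P x)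
    have hb : B5Blocks16.blockOf (nP P) (MP P) (eFine P x) = y' := by
      rw [← hyj]; exact blockOf_bpt (nP P) (MP P) y' j
    have hy : eUnit P y = y' := by rw [← h, eUnit_blk, hb]
    exact ⟨j, by rw [hy]; exact hyj.symm⟩
  · rintro ⟨j, hj⟩
    apply (eUnit P).injective
    rw [eUnit_blk, hj, blockOf_bpt]

/-- the offset map `j ↦ eFine⁻¹(n·eUnit y + j)` is injective. [cite: Balaban1984PropagatorsI, (1.6) p.18] -/
theorem offset_injective (y : Site P P.K) :
    Function.Injective fun j : Fin P.d → Fin (nP P) => (eFine P).symm (bpt (nP P) (MP P) (eUnit P y) j) := by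
  intro j j' h
  have h' := congr_arg (eFine P) h
  simp only [Equiv.apply_symm_apply] at h'
  have := (bpt_bijective (nP P) (MP P)).1 (a₁ := (eUnit P y, j)) (a₂ := (eUnit P y, j')) h'
  exact (Prod.mk.inj this).2

/-- the fibre `B^K(y)` is the image of the offsets. [cite: Balaban1984PropagatorsI, (1.6) p.18] -/
theorem fibre_eq_image (y : Site P P.K) :
    Finset.univ.filter (fun x : Site P 0 => Site.proj P.K P.K x = y)
      = Finset.univ.image fun j : Fin P.d → Fin (nP P) => (eFine P).symm (bpt (nP P) (MP P) (eUnit P y) j) := by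
  ext x
  simp only [Finset.mem_filter, Finset.mem_univ, true_and, Finset.mem_image]
  rw [proj_eq_iff]
  constructor
  · rintro ⟨j, hj⟩
    exact ⟨j, by rw [← hj, Equiv.symm_apply_apply]⟩
  · rintro ⟨j, hj⟩
    exact ⟨j, by rw [← hj, Equiv.apply_symm_apply]⟩

/-- the entry of p37's `Qv` as a double count: `Qv y x = η^{d+1}·#{(x′, t) : x′ ∈ B^K(y), t < L^K, x′ + tηe_μ = x}`.
[cite: Balaban1984PropagatorsI, (1.18) p.20] -/
theorem Qv_entry (μ : Fin P.d) (y : Site P P.K) (x : Site P 0) :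
    Qv P P.K μ y x = (((P.L : ℝ) ^ P.K)⁻¹) ^ (P.d + 1) *
      ∑ x' ∈ Finset.univ.filter (fun x' : Site P 0 => Site.proj P.K P.K x' = y),
        ∑ t ∈ Finset.range (P.L ^ P.K), (if shiftN P x' μ t = x then (1 : ℝ) else 0) := by
  classical
  have h := Qv_mulVec (P := P) (k := P.K) (Nat.le_add_left P.K P.m) μ (fun x'' => if x'' = x then (1 : ℝ) else 0) y
  have hl : (Qv P P.K μ *ᵥ fun x'' => if x'' = x then (1 : ℝ) else 0) y = Qv P P.K μ y x := by
    simp only [Matrix.mulVec, dotProduct, mul_ite, mul_one, mul_zero, Finset.sum_ite_eq', Finset.mem_univ, if_true]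
  rw [hl] at h
  exact h

/-- `(L^K)^{−1} = n^{−1}` and `n = L^K` as reals. [cite: Balaban1984PropagatorsI, p.35 («ε = L^{−K}»)] -/
theorem Lpow_K_eq : ((P.L : ℝ) ^ P.K) = (nP P : ℝ) := by simp [nP]

/-- **THE ENTRY IDENTITY**: the matrix (1.18) `QvOp` of the product-torus typing, between the bridged indices, is p37's `Qv`
per direction: `QvOp (eUnit y, μ) (eFine x, μ′) = [μ′ = μ]·Qv P K μ y x`. [cite: Balaban1984PropagatorsI, (1.18) p.20] -/
theorem QvOp_bridge (y : Site P P.K) (x : Site P 0) (μ μ' : Fin P.d) :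
    QvOp (nP P) (MP P) (eUnit P y, μ) (eFine P x, μ') = if μ' = μ then ((Qv P P.K μ y x : ℝ) : ℂ) else 0 := by
  classical
  by_cases hμ : μ' = μ
  · subst hμ
    rw [if_pos rfl, Qv_entry, fibre_eq_image, Finset.sum_image fun j _ j' _ h => offset_injective P y h]
    unfold QvOp
    rw [if_pos rfl]
    -- constants out, counts equal
    have hc : ∀ (j : Fin P.d → Fin (nP P)) (t : Fin (nP P)),
        (if eFine P x = bpt (nP P) (MP P) (eUnit P y) j + tstep (fine (nP P) (MP P)) μ' t then 1 / (nP P : ℂ) ^ (P.d + 1) else 0)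
          = 1 / (nP P : ℂ) ^ (P.d + 1) *
            (if shiftN P ((eFine P).symm (bpt (nP P) (MP P) (eUnit P y) j)) μ' t = x then (1 : ℂ) else 0) := by
      intro j t
      have hiff : (eFine P x = bpt (nP P) (MP P) (eUnit P y) j + tstep (fine (nP P) (MP P)) μ' t)
          ↔ (shiftN P ((eFine P).symm (bpt (nP P) (MP P) (eUnit P y) j)) μ' t = x) := by
        rw [← (eFine P).injective.eq_iff, eFine_shiftN, Equiv.apply_symm_apply, eq_comm]
      simp only [hiff, mul_ite, mul_one, mul_zero]
    simp_rw [hc, ← Finset.mul_sum]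
    rw [Lpow_K_eq, one_div, ← inv_pow]
    push_cast
    simp only [apply_ite ((↑) : ℝ → ℂ), Complex.ofReal_one, Complex.ofReal_zero]
    congr 1
    refine Finset.sum_congr rfl fun j _ => ?_
    rw [Finset.sum_range]
    rfl
  · rw [if_neg hμ]
    unfold QvOp
    rw [if_neg hμ]

/-- **a tower function on the unit lattice read on the product unit torus**: `embQ B (w, μ) = B_μ(eUnit⁻¹ w)`.
[cite: Balaban1984PropagatorsI, (1.18) p.20] -/
def embQ (B : Fin P.d → Site P P.K → ℝ) : Tor (MP P) × Fin P.d → ℂ := fun c => (B c.2 ((eUnit P).symm c.1) : ℂ)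

/-- unfolding. [cite: Balaban1984PropagatorsI, (1.18) p.20] -/
@[simp] theorem embQ_apply (B : Fin P.d → Site P P.K → ℝ) (w : Tor (MP P)) (μ : Fin P.d) :
    embQ P B (w, μ) = (B μ ((eUnit P).symm w) : ℂ) := rfl

/-- **`Q_K` agrees**: `QvOp *ᵥ embA A = embQ (μ ↦ Qv P K μ · A_μ)`. [cite: Balaban1984PropagatorsI, (1.18) p.20] -/
theorem QvOp_embA (A : Fin P.d → Site P 0 → ℝ) :
    QvOp (nP P) (MP P) *ᵥ embA P A = embQ P (fun μ => Qv P P.K μ *ᵥ A μ) := by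
  classical
  funext c
  obtain ⟨w, μ⟩ := c
  obtain ⟨y, rfl⟩ : ∃ y, eUnit P y = w := ⟨(eUnit P).symm w, (eUnit P).apply_symm_apply w⟩
  rw [embQ_apply, Equiv.symm_apply_apply]
  simp only [Matrix.mulVec, dotProduct]
  rw [← ((eFine P).prodCongr (Equiv.refl (Fin P.d))).sum_comp]
  simp only [Equiv.prodCongr_apply, Equiv.coe_refl]
  rw [Fintype.sum_prod_type]
  simp only [Prod.map_apply, id_eq, QvOp_bridge, embA_apply, Equiv.symm_apply_apply, ite_mul, zero_mul,
    Finset.sum_ite_eq', Finset.mem_univ, if_true]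
  push_cast
  rfl

/-- `(L^d)^{lvl K} = n^d` as reals. [cite: Balaban1984PropagatorsI, (1.21) p.21 (η^{−d})] -/
theorem Lpow_d_lvl_eq : (((P.L : ℝ) ^ P.d) ^ lvl P P.K) = ((nP P : ℝ)) ^ P.d := by
  rw [lvl_of_le P (Nat.le_add_left P.K P.m), ← pow_mul, mul_comm, pow_mul, Lpow_K_eq]

/-- **`Q*_K` agrees**: `QvAdj *ᵥ embQ B = embA (μ ↦ QvT P K μ · B_μ)` (both are `η^{−d}` times the transpose).
[cite: Balaban1984PropagatorsI, (1.18) p.20, (1.21) p.21] -/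
theorem QvAdj_embQ (B : Fin P.d → Site P P.K → ℝ) :
    QvAdj (nP P) (MP P) *ᵥ embQ P B = embA P (fun μ => QvT P P.K μ *ᵥ B μ) := by
  classical
  funext b
  obtain ⟨z, μ'⟩ := b
  obtain ⟨x, rfl⟩ : ∃ x, eFine P x = z := ⟨(eFine P).symm z, (eFine P).apply_symm_apply z⟩
  rw [embA_apply, Equiv.symm_apply_apply, QvT, Matrix.smul_mulVec, Pi.smul_apply, smul_eq_mul, Lpow_d_lvl_eq,
    Matrix.mulVec_transpose, B5DeltaA169.QvAdj_mulVec, Pi.smul_apply, smul_eq_mul]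
  push_cast
  congr 1
  simp only [Matrix.mulVec, Matrix.vecMul, dotProduct, Matrix.conjTranspose_apply]
  rw [← ((eUnit P).prodCongr (Equiv.refl (Fin P.d))).sum_comp]
  simp only [Equiv.prodCongr_apply, Equiv.coe_refl]
  rw [Fintype.sum_prod_type]
  simp only [Prod.map_apply, id_eq, QvOp_bridge, embQ_apply, Equiv.symm_apply_apply, apply_ite star, star_zero,
    Complex.star_def, Complex.conj_ofReal, ite_mul, zero_mul, Finset.sum_ite_eq, Finset.mem_univ, if_true]
  push_cast
  exact Finset.sum_congr rfl fun y _ => mul_comm _ _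

/-- **`Δ + aQ*Q` IS THE SAME OPERATOR IN THE TWO TYPINGS**: `G0inv n M a *ᵥ embA A = embA (μ ↦ M0 P a 0 K μ · A_μ)`
(`G0inv = Lap + a·QvAdj·QvOp`, p251794; `M0 P a 0 K μ = hOp P 0 ε 0 + a·QvT·Qv`, p37 `M0_top`).
[cite: Balaban1984PropagatorsI, (1.132)–(1.134) p.39] -/
theorem G0inv_embA (a : ℝ) (A : Fin P.d → Site P 0 → ℝ) :
    G0inv (nP P) (MP P) a *ᵥ embA P A = embA P (fun μ => M0 P a 0 P.K μ *ᵥ A μ) := by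
  rw [G0inv, Matrix.add_mulVec, Matrix.smul_mulVec, ← Matrix.mulVec_mulVec, QvOp_embA, QvAdj_embQ, embA_Lap,
    ← embA_add_smul]
  congr 1
  funext μ
  rw [M0_top, H, Matrix.add_mulVec, Matrix.smul_mulVec, ← Matrix.mulVec_mulVec]

end

end Literature.MathematicalPhysics.QuantumFieldTheory.Balaban1983to89.B5G0BridgeP12
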